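import Summits.QuantumFields.BalabanUV.T4Continuum.Spine.NE2.ComposedRemainderGaugeTower
import Summits.QuantumFields.BalabanUV.T4Continuum.Spine.NE2.OneStepRemainderLoopFlat
import Summits.QuantumFields.BalabanUV.T4Continuum.Spine.NE2BalabanFlatWitness

/-!
# T⁴ programme, spine node NE2 (U1a) — R14 W3c, file 9: NON-VACUITY OF THE GAUGE-TOWER END AT THE FLAT TOWER `U ≡ 1` (cell `pub-balaban-gaps`, seat ne2 gen 6; companion of
# `ComposedRemainderGaugeTower`, cf. gen 4's `ComposedAveragingFlatWitness`)

`ComposedRemainderGaugeTower.composed_full_averaging_rate_of_gaugeTowers` displays, besides the tier-B data (`hreg`, `hNE3`, `hP₄`, `hsmall`) and the frame, LETTERS on the towers of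
unitary bond variables (`hUa`, `hUc`, `hp`/`hpL`, `hYP`, `hcU0`/`hUd`) and the real inequalities `hΓ`, `hE`, `hrate`.  THIS FILE checks that the binder set is JOINTLY SATISFIABLE: at the
flat point — `R :=` the flat transporters (`regularTransporters_flat`, `localRate_flat`), every `U k i ν b := 1` (so `α_U = σ_U = θ_c = c_U = p = 0`, the loop logarithms vanish by
`OneStepRemainderLoopFlat.YxT_one`, hence lie in `P`), `P₄ := 0`, `Γ = E = C_r = 0` — all of them hold and the END applies, for every component family `hF` (no Lie-closure hypothesis: `lie_mem_of_stable`) and every `L ≥ 2`, `d ≥ 1`,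
`3/(2L) ≤ ρ < 1` (**`composed_full_averaging_rate_of_gaugeTowers_flat`**, the rate constant left existential).  NOT a statement about non-trivial data.
HONEST FRAMING (T4-DAG p. 1).  [folklore] non-vacuity bookkeeping on MODEL objects; nothing of Bałaban's asserted; NOT NE2; **NE2 (U1a) NOT PROVED**; spine PROVED 0/9 unchanged; NOT continuum
YM / infinite volume / mass gap / Clay.  No `sorry`.
-/

noncomputable section

open scoped BigOperators ComplexConjugate Matrix Matrix.Norms.L2Operator Kronecker
open Finset (range)

namespace Summit.QuantumFields.BalabanUV.T4Continuum.NE2.ComposedRemainderGaugeTowerFlat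

open Literature.MathematicalPhysics.QuantumFieldTheory.Balaban1983to89.B5Prop11Plancherel (Tor fine unitVec Cst)
open Literature.MathematicalPhysics.QuantumFieldTheory.Balaban1983to89.B5G183RateUnitTower (lev lev_neZero)
open Literature.MathematicalPhysics.QuantumFieldTheory.Balaban1983to89.B9AdOrthogonal (form)
open Summit.QuantumFields.BalabanUV.Beta.AdjointCarrierWiringEnd (CompFamily)
open Summit.QuantumFields.BalabanUV.T4Continuum
open Summit.QuantumFields.BalabanUV.T4Continuum.BalabanAveragedTowerUnit (idx Qlev)
open Summit.QuantumFields.BalabanUV.T4Continuum.KingPairingPlantedLaw (JpcT calDalev)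
open Summit.QuantumFields.BalabanUV.T4Continuum.CovariantAveragingTower (TowerLimitRate)
open Summit.QuantumFields.BalabanUV.T4Continuum.BackgroundResolventTower (PerturbationLaws)
open Summit.QuantumFields.BalabanUV.T4Continuum.PerturbationAlgebra (perturbationLaws_zero perturbationLaws_mono)
open Summit.QuantumFields.BalabanUV.T4Continuum.RegularBackgroundTower (betaNE3)
open Summit.QuantumFields.BalabanUV.T4Continuum.ColourCovariantLaplacian (kappaCol)
open Summit.QuantumFields.BalabanUV.T4Continuum.CovariantAveragingSummand (kappaQ)
open Summit.QuantumFields.BalabanUV.T4Continuum.NE2BalabanLayer (tierBPert kappaB)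
open Summit.QuantumFields.BalabanUV.T4Continuum.NE2BalabanGauge (liftR)
open Summit.QuantumFields.BalabanUV.T4Continuum.GaugeTermPerturbationLaw (oneR)
open Summit.QuantumFields.BalabanUV.T4Continuum.NE2BalabanFlatWitness (regularTransporters_flat localRate_flat)
open Summit.QuantumFields.BalabanUV.T4Continuum.NE2.CovariantTableBalaban (TBal)
open Summit.QuantumFields.BalabanUV.T4Continuum.NE2.CovariantTableBalabanTwoLevel (consBal)
open Summit.QuantumFields.BalabanUV.T4Continuum.NE2.ComposedAveragingRemainder (avgPertFull)
open Summit.QuantumFields.BalabanUV.T4Continuum.NE2.ComposedRemainderTower (Erem cR)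
open Summit.QuantumFields.BalabanUV.T4Continuum.NE2.ComposedRemainderTwoLevel (sameBnd crossBnd DeltaStep epsStep deltaS)
open Summit.QuantumFields.BalabanUV.T4Continuum.NE2.OneStepRemainderLoopCoeff (YxT remCoeffOf)
open Summit.QuantumFields.BalabanUV.T4Continuum.NE2.OneStepRemainderLoopFlat (YxT_one)
open Summit.QuantumFields.BalabanUV.T4Continuum.NE2.ComposedRemainderGaugeTower (fundT adT composed_full_averaging_rate_of_gaugeTowers)

variable {d : ℕ} (L : ℕ) [NeZero L] (M : Fin d → ℕ) [hM : ∀ μ, NeZero (M μ)]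
  {n : Type} [Fintype n] [DecidableEq n] [Nonempty n] {ι : Type} [Fintype ι] [DecidableEq ι] [Nonempty ι] {c : ℝ} {P : Submodule ℝ (Matrix n n ℂ)} {e : ι → Matrix n n ℂ}
  (hF : CompFamily c P e) (a : ℝ) (ha : 0 < a)

/-- the flat tower of unitary bond variables `U ≡ 1`. [folklore] -/
def flatU : (i : ℕ) → Fin d → (idx L M i → Matrix.unitaryGroup n ℂ) := fun _ _ _ => 1

omit [NeZero L] hM [Nonempty n] in
/-- its fundamental reading is the constant `1`. [folklore] -/
theorem fundT_flatU : fundT L M (flatU L M (n := n)) = fun _ _ _ => 1 := rfl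

include ha in
/-- **NON-VACUITY OF THE GAUGE-TOWER END**: at the flat point (`R` flat, `U ≡ 1`, `P₄ = 0`, all letters `0`) every displayed binder of `composed_full_averaging_rate_of_gaugeTowers` holds, for any
component family `hF`, `L ≥ 2`, `d ≥ 1`, `3/(2L) ≤ ρ < 1`.  NOT a statement about non-trivial data; NE2 NOT proved. [folklore] -/
theorem composed_full_averaging_rate_of_gaugeTowers_flat (hL : 2 ≤ L) (hd : 1 ≤ d) {ρ : ℝ} (hρ : 3 / (2 * (L : ℝ)) ≤ ρ) (hρ1 : ρ < 1) :
    ∃ Cp : ℝ, TowerLimitRate (fun k => Qlev L M k ⊗ₖ (1 : Matrix ι ι ℂ)) ((L : ℝ) ^ d)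
      (fun k => (calDalev L M a ha k ⊗ₖ (1 : Matrix ι ι ℂ)
        + tierBPert L M (liftR L M (oneR L M (o := ι))) (avgPertFull L M a (fun k => TBal L M (adT L M hF (flatU L M)) k)
            (fun k => Erem L M (adT L M hF (flatU L M)) (remCoeffOf L M (fundT L M (flatU L M)) c e (adT L M hF (flatU L M))) k)) (fun _ => 0) k)⁻¹) Cp ρ := by
  have hρ0 : 0 ≤ ρ := le_trans (by positivity) hρ
  have hone : ∀ (i : ℕ) (ν : Fin d) (b : idx L M i), ((flatU L M (n := n) i ν b : Matrix.unitaryGroup n ℂ) : Matrix n n ℂ) = 1 := fun _ _ _ => rfl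
  have hP₄ : PerturbationLaws (fun k => calDalev L M a ha k ⊗ₖ (1 : Matrix ι ι ℂ)) (fun k => (0 : Matrix (idx L M k × ι) (idx L M k × ι) ℂ))
      (fun k => JpcT L M k ⊗ₖ (1 : Matrix ι ι ℂ)) 0 (fun k => (0 : ℝ) * ρ ^ k) :=
    perturbationLaws_mono perturbationLaws_zero le_rfl fun k => le_of_eq (by ring)
  have hexp : Real.exp ((((d + 1) * L : ℕ) : ℝ) * (2 * 0)) - 1 = 0 := by rw [mul_zero, mul_zero, Real.exp_zero, sub_self]
  have hsmall : kappaB ι d a 0 0 0 (kappaQ d a (a : ℂ) (Fintype.card ι * (Real.exp ((((d + 1) * L : ℕ) : ℝ) * (2 * 0)) - 1)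
      + (1 + Fintype.card ι * (Real.exp ((((d + 1) * L : ℕ) : ℝ) * (2 * 0)) - 1)) * cR d L ι * 0 * Real.exp 0)) 0 < 1 := by
    rw [hexp]
    simp [kappaB, kappaCol, kappaQ, betaNE3]
  have hsig : ∀ i : ℕ, (1 + 2 * (0 : ℝ) / (lev L (i + 1) : ℕ)) ^ ((d + 1) * L) - 1 = 0 := fun i => by rw [mul_zero, zero_div, add_zero, one_pow, sub_self]
  have hcons : ∀ k : ℕ, consBal d L (fun _ => 2 * (0 : ℝ)) k = 0 := fun k => by
    unfold consBal
    refine List.sum_eq_zero fun x hx => ?_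
    obtain ⟨i, _, rfl⟩ := List.mem_map.mp hx
    rw [mul_zero, add_zero, one_pow, sub_self]
  have hrate : ∀ k : ℕ,
      sameBnd d L ι (Cst d a) ((1 + Fintype.card ι * (Real.exp ((((d + 1) * L : ℕ) : ℝ) * (2 * 0)) - 1)) * cR d L ι * 0 * Real.exp 0)
          (1 + Fintype.card ι * (Real.exp ((((d + 1) * L : ℕ) : ℝ) * (2 * 0)) - 1) + (1 + Fintype.card ι * (Real.exp ((((d + 1) * L : ℕ) : ℝ) * (2 * 0)) - 1)) * cR d L ι * 0 * Real.exp 0)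
          ((1 + 2 * 0 / (lev L (k + 1) : ℕ)) ^ ((d + 1) * L) - 1) (64 * (d * (L : ℝ) ^ 2 * (fun (_ : ℕ) (_ : ℕ) => (0 : ℝ)) (k + 1) (k + 1))) (lev L k)
        + crossBnd ι (Cst d a) (1 + Fintype.card ι * (Real.exp ((((d + 1) * L : ℕ) : ℝ) * (2 * 0)) - 1) + (1 + Fintype.card ι * (Real.exp ((((d + 1) * L : ℕ) : ℝ) * (2 * 0)) - 1)) * cR d L ι * 0 * Real.exp 0)
          (∑ i ∈ range k, DeltaStep d L ι (2 * (fun (_ : ℕ) (_ : ℕ) => (0 : ℝ)) k (i + 1)) (64 * (d * (L : ℝ) ^ 2 * (fun (_ : ℕ) (_ : ℕ) => (0 : ℝ)) k (i + 1)))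
            (192 * ((d + 1) * L) * (fun (_ : ℕ) (_ : ℕ) => (0 : ℝ)) k (i + 1)) (2 * (fun (_ : ℕ) (_ : ℕ) => (0 : ℝ)) k i))
          (∏ i ∈ range k, (1 + epsStep d L ι ((1 + 2 * 0 / (lev L (i + 1) : ℕ)) ^ ((d + 1) * L) - 1) (64 * (d * (L : ℝ) ^ 2 * (fun (_ : ℕ) (_ : ℕ) => (0 : ℝ)) (k + 1) (i + 1)))))
          (consBal d L (fun i => 2 * (fun (_ : ℕ) (_ : ℕ) => (0 : ℝ)) k i) k)
        ≤ 0 * ρ ^ k := by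
    intro k
    rw [hsig, hcons, zero_mul]
    simp [sameBnd, crossBnd, DeltaStep, deltaS]
  refine ⟨_, composed_full_averaging_rate_of_gaugeTowers L M hF a ha hL hd (regularTransporters_flat L M) le_rfl
    (localRate_flat L M le_rfl (inv_nonneg.mpr (Nat.cast_nonneg L))) (U := fun _ => flatU L M) (αU := 0) (σU := 0) (θc := 0) le_rfl le_rfl le_rfl zero_le_one hρ0 hρ hρ1
    (fun _ _ _ _ => by rw [hone, sub_self, norm_zero]; positivity) (fun _ _ _ _ _ => by rw [hone, sub_self, norm_zero]; positivity)
    (p := fun _ _ => 0) (fun _ _ => le_rfl) (fun _ _ _ _ _ => by rw [fundT_flatU]; simp) (fun _ _ => by norm_num)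
    (fun _ i x μ r => by rw [fundT_flatU, YxT_one]; exact P.zero_mem) (cU := fun _ _ => 0) (Γ := 0) (E := 0) (Cr := 0) (fun _ _ => le_rfl)
    (fun _ _ _ _ => by rw [hone, sub_self, norm_zero])
    (fun _ k' => by simp) (fun _ k' => Finset.sum_nonpos fun i _ => by rw [hsig, mul_zero, mul_zero, mul_zero, mul_zero, add_zero])
    hrate hP₄ hsmall⟩

end Summit.QuantumFields.BalabanUV.T4Continuum.NE2.ComposedRemainderGaugeTowerFlat

end
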